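import Literature.NumberTheory.Automorphic.UnitaryGroupArthurTruncatedTrace
import HarnessLib

/-!
# `J^T(f)` is a polynomial of degree `≤ 1` in `log T` as soon as its WINDOW INCREMENTS are
# `C · (log T' − log T)` — the terminal algebra of the LAW 2 road
(Rogawski, *Automorphic Representations of Unitary Groups in Three Variables* (1990), §2.1 p. 12
«each term in (2.1.1) is a polynomial in `T`»; Shokranian, *The Selberg–Arthur Trace Formula*,
LNM 1503 (1992), Thm. (5.7), Rem. (5.8)(a); Arthur, Ann. of Math. 114 (1981), Prop. 2.3)

Topic `NumberTheory/Automorphic`; namespace `Literature.NumberTheory.Automorphic.UnitaryGroup`.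
THEOREMS ONLY over the accepted module ★ `UnitaryGroupArthurTruncatedTrace` (`truncatedTrace`,
`IsTruncatedTracePolynomial`, `truncatedTracePolynomial`, `arthurTrace`): no definition, no named fact,
no instance, no notation, no `sorry`. Brick (L2-e₁) of the road to the T1-qs law ★
`UnitaryGroup.TruncatedTracePolynomial` (cell `hodgecm-mathlib`, crux H413, F0P3a-p04 (g5)'s LAW 2
road): the analytic bricks (L2-a)(L2-u)(L2-i)(L2-i′)(L2-dT)(L2-d) produce a threshold `T₁` and a
constant `C_f ∈ ℂ` with

  `J^{T'}(f) − J^{T}(f) = C_f · (log T' − log T)`   for all `T₁ < T ≤ T'`;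

this file turns that WINDOW LAW into the printed statement «`J^T(f) = p(log T)`, `deg p ≤ 1`»
(`exists_isTruncatedTracePolynomial_of_window`), names the polynomial
(`truncatedTracePolynomial_eq_of_window`, `natDegree_truncatedTracePolynomial_le_one_of_window`) and
reads off Arthur's `J(f) = p(0) = J^{T₂}(f) − C_f log T₂` at any anchor `T₂ > T₁`
(`arthurTrace_eq_of_window`). Pure algebra: a function on `(T₁, ∞)` with increments proportional to
the increments of `log` is affine in `log`.

HC_CM is proved only modulo the 7 printed citations until rung 0 closes — nothing here bears on a summit
statement.

## References

* J. D. Rogawski, *Automorphic Representations of Unitary Groups in Three Variables*, Annals of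
  Mathematics Studies 123 (1990), §2.1 (p. 12) [Rogawski1990].
* S. Shokranian, *The Selberg–Arthur Trace Formula*, LNM 1503 (1992), Thm. (5.7), Rem. (5.8)
  [Shokranian1992].
-/

set_option autoImplicit false

noncomputable section

open MeasureTheory NumberField Polynomial
open scoped NNReal

namespace Literature.NumberTheory.Automorphic

namespace UnitaryGroup

variable {F E : Type} [Field F] [NumberField F] [Field E] [NumberField E] [Algebra F E]
  {c : E ≃ₐ[F] E} {N : ℕ} [NeZero N] [MeasurableSpace (adelicUnipotent F E c N)]

/-- The affine polynomial `a + b X` has degree `≤ 1`. [cite: Shokranian1992, Thm. (5.7) and Rem. (5.8)] -/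
theorem natDegree_C_add_C_mul_X_le_one (a b : ℂ) : (C a + C b * X).natDegree ≤ 1 := by
  refine (natDegree_add_le _ _).trans (max_le ?_ ?_)
  · exact (natDegree_C a).le.trans zero_le_one
  · exact (natDegree_C_mul_le _ _).trans natDegree_X_le

/-- Evaluation of the affine polynomial: `(a + b X)(z) = a + b z`.
[cite: Shokranian1992, Thm. (5.7) and Rem. (5.8)] -/
theorem eval_C_add_C_mul_X (a b z : ℂ) : (C a + C b * X).eval z = a + b * z := by
  rw [eval_add, eval_C, eval_mul, eval_C, eval_X]

/-- **WINDOW LAW ⇒ AFFINE IN `log T` (explicit polynomial).** If above a threshold `T₁` the window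
increments of `J^T(f)` are `C_f · (log T' − log T)`, then for every anchor `T₂ > T₁` the affine
polynomial `p = (J^{T₂}(f) − C_f log T₂) + C_f X` computes `J^T(f) = p(log T)` for all `T > T₂`.
[cite: Rogawski1990, §2.1 (p. 12)] [cite: Shokranian1992, Thm. (5.7) and Rem. (5.8)] -/
theorem isTruncatedTracePolynomial_of_window {μ : Measure (quasiSplit F E c N).automorphicQuotient}
    {ν : Measure (adelicUnipotent F E c N)} {𝓕 : Set (adelicUnipotent F E c N)}
    {f : (quasiSplit F E c N).Adelic → ℂ} {T₁ : ℝ≥0} {Cf : ℂ}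
    (h : ∀ T T' : ℝ≥0, T₁ < T → T ≤ T' →
      truncatedTrace μ ν 𝓕 T' f - truncatedTrace μ ν 𝓕 T f =
        Cf * (((Real.log (T' : ℝ) - Real.log (T : ℝ) : ℝ)) : ℂ))
    {T₂ : ℝ≥0} (hT₂ : T₁ < T₂) :
    IsTruncatedTracePolynomial μ ν 𝓕 f
      (C (truncatedTrace μ ν 𝓕 T₂ f - Cf * ((Real.log (T₂ : ℝ) : ℝ) : ℂ)) + C Cf * X) := by
  refine ⟨T₂, fun T hT => ?_⟩
  have hw := h T₂ T hT₂ hT.le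
  rw [eval_C_add_C_mul_X]
  -- `J^T = J^{T₂} + C_f (log T − log T₂)`
  have e : truncatedTrace μ ν 𝓕 T f =
      truncatedTrace μ ν 𝓕 T₂ f + Cf * (((Real.log (T : ℝ) - Real.log (T₂ : ℝ) : ℝ)) : ℂ) := by
    rw [← hw]; ring
  rw [e]
  push_cast
  ring

/-- **WINDOW LAW ⇒ `J^T(f)` IS A POLYNOMIAL OF DEGREE `≤ 1` IN `log T`** — the conclusion of the named
fact ★ `UnitaryGroup.TruncatedTracePolynomial` for ONE datum `(ν, 𝓕, μ, f)`, from the window law above a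
threshold. [cite: Rogawski1990, §2.1 (p. 12)] [cite: Shokranian1992, Thm. (5.7) and Rem. (5.8)] -/
theorem exists_isTruncatedTracePolynomial_of_window {μ : Measure (quasiSplit F E c N).automorphicQuotient}
    {ν : Measure (adelicUnipotent F E c N)} {𝓕 : Set (adelicUnipotent F E c N)}
    {f : (quasiSplit F E c N).Adelic → ℂ} {T₁ : ℝ≥0} {Cf : ℂ}
    (h : ∀ T T' : ℝ≥0, T₁ < T → T ≤ T' →
      truncatedTrace μ ν 𝓕 T' f - truncatedTrace μ ν 𝓕 T f =
        Cf * (((Real.log (T' : ℝ) - Real.log (T : ℝ) : ℝ)) : ℂ)) :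
    ∃ p : ℂ[X], p.natDegree ≤ 1 ∧ IsTruncatedTracePolynomial μ ν 𝓕 f p :=
  ⟨_, natDegree_C_add_C_mul_X_le_one _ _, isTruncatedTracePolynomial_of_window h (lt_add_one T₁)⟩

/-- Under the window law Arthur's polynomial `truncatedTracePolynomial` IS the affine polynomial anchored
at any `T₂ > T₁` (uniqueness ★ `IsTruncatedTracePolynomial.unique`).
[cite: Shokranian1992, Thm. (5.7) and Rem. (5.8)] -/
theorem truncatedTracePolynomial_eq_of_window {μ : Measure (quasiSplit F E c N).automorphicQuotient}
    {ν : Measure (adelicUnipotent F E c N)} {𝓕 : Set (adelicUnipotent F E c N)}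
    {f : (quasiSplit F E c N).Adelic → ℂ} {T₁ : ℝ≥0} {Cf : ℂ}
    (h : ∀ T T' : ℝ≥0, T₁ < T → T ≤ T' →
      truncatedTrace μ ν 𝓕 T' f - truncatedTrace μ ν 𝓕 T f =
        Cf * (((Real.log (T' : ℝ) - Real.log (T : ℝ) : ℝ)) : ℂ))
    {T₂ : ℝ≥0} (hT₂ : T₁ < T₂) :
    truncatedTracePolynomial μ ν 𝓕 f =
      C (truncatedTrace μ ν 𝓕 T₂ f - Cf * ((Real.log (T₂ : ℝ) : ℝ) : ℂ)) + C Cf * X :=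
  truncatedTracePolynomial_eq (isTruncatedTracePolynomial_of_window h hT₂)

/-- Under the window law Arthur's polynomial has degree `≤ 1`.
[cite: Shokranian1992, Thm. (5.7) and Rem. (5.8)] -/
theorem natDegree_truncatedTracePolynomial_le_one_of_window
    {μ : Measure (quasiSplit F E c N).automorphicQuotient}
    {ν : Measure (adelicUnipotent F E c N)} {𝓕 : Set (adelicUnipotent F E c N)}
    {f : (quasiSplit F E c N).Adelic → ℂ} {T₁ : ℝ≥0} {Cf : ℂ}
    (h : ∀ T T' : ℝ≥0, T₁ < T → T ≤ T' →
      truncatedTrace μ ν 𝓕 T' f - truncatedTrace μ ν 𝓕 T f =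
        Cf * (((Real.log (T' : ℝ) - Real.log (T : ℝ) : ℝ)) : ℂ)) :
    (truncatedTracePolynomial μ ν 𝓕 f).natDegree ≤ 1 := by
  rw [truncatedTracePolynomial_eq_of_window h (lt_add_one T₁)]
  exact natDegree_C_add_C_mul_X_le_one _ _

/-- The linear coefficient of Arthur's polynomial is the window constant `C_f`.
[cite: Shokranian1992, Thm. (5.7) and Rem. (5.8)] -/
theorem coeff_one_truncatedTracePolynomial_of_window
    {μ : Measure (quasiSplit F E c N).automorphicQuotient}
    {ν : Measure (adelicUnipotent F E c N)} {𝓕 : Set (adelicUnipotent F E c N)}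
    {f : (quasiSplit F E c N).Adelic → ℂ} {T₁ : ℝ≥0} {Cf : ℂ}
    (h : ∀ T T' : ℝ≥0, T₁ < T → T ≤ T' →
      truncatedTrace μ ν 𝓕 T' f - truncatedTrace μ ν 𝓕 T f =
        Cf * (((Real.log (T' : ℝ) - Real.log (T : ℝ) : ℝ)) : ℂ)) :
    (truncatedTracePolynomial μ ν 𝓕 f).coeff 1 = Cf := by
  rw [truncatedTracePolynomial_eq_of_window h (lt_add_one T₁)]
  simp

/-- **Arthur's `J(f)` under the window law**: `J(f) = p(0) = J^{T₂}(f) − C_f · log T₂` at every anchor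
`T₂ > T₁` (in particular the right-hand side does not depend on the anchor).
[cite: Shokranian1992, Thm. (5.7) and Rem. (5.8)] -/
theorem arthurTrace_eq_of_window {μ : Measure (quasiSplit F E c N).automorphicQuotient}
    {ν : Measure (adelicUnipotent F E c N)} {𝓕 : Set (adelicUnipotent F E c N)}
    {f : (quasiSplit F E c N).Adelic → ℂ} {T₁ : ℝ≥0} {Cf : ℂ}
    (h : ∀ T T' : ℝ≥0, T₁ < T → T ≤ T' →
      truncatedTrace μ ν 𝓕 T' f - truncatedTrace μ ν 𝓕 T f =
        Cf * (((Real.log (T' : ℝ) - Real.log (T : ℝ) : ℝ)) : ℂ))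
    {T₂ : ℝ≥0} (hT₂ : T₁ < T₂) :
    arthurTrace μ ν 𝓕 f = truncatedTrace μ ν 𝓕 T₂ f - Cf * ((Real.log (T₂ : ℝ) : ℝ) : ℂ) := by
  rw [arthurTrace_eq_eval (isTruncatedTracePolynomial_of_window h hT₂), eval_C_add_C_mul_X, mul_zero,
    add_zero]

/-- If moreover the anchor can be taken at `T₂ = 1` (i.e. `T₁ < 1`), then `J(f) = J^{1}(f)`: Arthur's
distribution is the truncated trace at the canonical point `log T = 0`.
[cite: Shokranian1992, Thm. (5.7) and Rem. (5.8)] -/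
theorem arthurTrace_eq_truncatedTrace_one_of_window {μ : Measure (quasiSplit F E c N).automorphicQuotient}
    {ν : Measure (adelicUnipotent F E c N)} {𝓕 : Set (adelicUnipotent F E c N)}
    {f : (quasiSplit F E c N).Adelic → ℂ} {T₁ : ℝ≥0} {Cf : ℂ}
    (h : ∀ T T' : ℝ≥0, T₁ < T → T ≤ T' →
      truncatedTrace μ ν 𝓕 T' f - truncatedTrace μ ν 𝓕 T f =
        Cf * (((Real.log (T' : ℝ) - Real.log (T : ℝ) : ℝ)) : ℂ))
    (hT₁ : T₁ < 1) : arthurTrace μ ν 𝓕 f = truncatedTrace μ ν 𝓕 1 f := by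
  rw [arthurTrace_eq_of_window h hT₁, NNReal.coe_one, Real.log_one, Complex.ofReal_zero, mul_zero,
    sub_zero]

end UnitaryGroup

end Literature.NumberTheory.Automorphic
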